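/-
Copyright (c) 2026 the pub-hodgecm-mathlib formalisation cell (harness21).  Prover seat hodgecm-mathlib-F0P3b-p01 (g24); E1 keeper ∕ dealer
F0P3a-p03 (g28) (E1 ledger row 20 «INTERTWINER-TRANSPORT», LEAD F0P3a-plan (g16) rule-20 generic brick); 2026-09-03.
-/
import Literature.NumberTheory.Automorphic.SmoothInductionFrobeniusNaturality   -- ★ FN p852974 `frobeniusInv_comp_eq`, `frobeniusNormalized_symm_comp` (+ ★ `JacquetModule`, ★ `SmoothInduction`)
import Literature.NumberTheory.Automorphic.JacquetModuleExactProofs             -- ★ `jacquetMap_injective`, `jacquetMap_exact`, `jacquetMap_surjective`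
import HarnessLib

/-!
# Transport of intertwining maps: restriction to a subgroup, twist by a character, and the NORMALISED Jacquet map
# `r_P(f) : r_P π → r_P π′` (Bernstein–Zelevinsky 1977 §1.8–§1.9; Casselman 1995 §3.1–§3.2)

Topic `NumberTheory/Automorphic`; namespace `Representation` (dot-notation neighbourhood of ★ `Representation.jacquetMap` ∕ ★
`Representation.normalizedJacquet`, `Automorphic/JacquetModule`).  THEOREMS ONLY (no definition, no instance, no notation, no named fact):
the three «same linear map, other representation structure» facts that ★ `SmoothInductionFrobeniusNaturality` (FN) phrases
hypothesis-style, as `∃`-headed theorems, plus their bookkeeping.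

* §1 RESTRICTION and TWIST (`k` any commutative ring): `exists_intertwiningMap_comp_subtype` (`f` is an `H`-map `π|_H → π′|_H`),
  `exists_intertwiningMap_twist` (`f` is a `G`-map `π ⊗ χ → π′ ⊗ χ`), `exists_intertwiningMap_comp_twist` (an `M`-map `σ → σ′` is a `P`-map
  `(σ ∘ φ) ⊗ χ → (σ′ ∘ φ) ⊗ χ`, the inflation-and-twist of normalised induction).  The BUNDLED forms exist in the tree as definitions —
  ★ `IntertwiningMap.restrictSubgroup` (`Automorphic/SmoothDualLevel`), ★ `IntertwiningMap.twist` ∕ `IntertwiningMap.ofTwist`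
  (`Automorphic/SupercuspidalProjectiveGL`), ★ `IntertwiningMap.compTwist` (`Automorphic/ParabolicGLExactProofs`) — and are CITED, not restated:
  the `∃`-heads here let a consumer obtain the map without importing those (heavier) modules.
* §2 THE NORMALISED JACQUET MAP: `jacquetMap t f` (★, `[v] ↦ [f v]` on `r_P π = π_N`) intertwines the NORMALISED actions `r_P π = π_N ⊗ δ_P^{−1∕2}`
  (the twist is the same scalar on both sides): `exists_normalizedJacquet_intertwiningMap` (`∃ g : r_P π →_M r_P π′` with `g.toLinearMap =
  (jacquetMap t f).toLinearMap`), its `mk`-form, functoriality of ★ `jacquetMap` (`jacquetMap_comp`, `jacquetMap_id_toLinearMap`), and the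
  SHORT-EXACT package `exists_normalizedJacquet_shortExact` (injective ∕ exact ∕ surjective transfer of ★ `jacquetMap_injective` ∕ `_exact` ∕
  `_surjective` to the normalised maps).
* §3 HYPOTHESIS-FREE FROBENIUS NATURALITY: ★ FN's `frobeniusInv_comp_eq` (restriction) and `frobeniusNormalized_symm_comp` (normalised Jacquet map)
  with their `hφ` ∕ `hψ` hypotheses DISCHARGED by §1 ∕ §2: `exists_frobeniusInv_comp`, `exists_frobeniusNormalized_symm_comp`.
Consumers (cell `pub/hodgecm-mathlib`, crux H413, E1 column): MEMO «K4′ SPINE WITHOUT Ext» v2 S7∕S8 at the datum («FN @ DATUM»); exponent ∕ length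
bookkeeping on normalised Jacquet modules along short exact sequences (★ `JacquetLineExponents`, ★ `JacquetLineCases` currently pass the pointwise
intertwining fact by hand).
HONEST LABEL: count-neutral generic helper; HC_CM is proved only modulo the printed citations (2 remaining named inputs hLiu418, h413) until rung 0 closes.

## References
* [BernsteinZelevinsky1977] I. N. Bernstein, A. V. Zelevinsky, *Induced representations of reductive p-adic groups I*, Ann. Sci. ÉNS 10 (1977),
  §1.8 (the functors `i_{U,θ}`, `r_{U,θ}` and their functoriality), §1.9 Prop. 1.9 (a)–(b) (exactness, adjunction), §2.3 (normalisation).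
* [Casselman1995] W. Casselman, *Introduction to the theory of admissible representations of p-adic reductive groups* (1995), §3.1 (the Jacquet
  module as a functor), §3.2 Thm. 3.2.3–3.2.4 (exactness, Frobenius reciprocity).
* [BushnellHenniart2006] C. J. Bushnell, G. Henniart, *The Local Langlands Conjecture for GL(2)*, §2.4 (restriction), §9.5 (9.5.1) p. 65 (twists).
-/

set_option autoImplicit false

noncomputable section

namespace Representation

open Literature.NumberTheory.Automorphic

/-! ## §1 Restriction to a subgroup and twist by a character: the same linear map intertwines -/

section RestrictTwist

variable {k G V V' : Type*} [CommRing k] [Group G] [AddCommGroup V] [Module k V] [AddCommGroup V'] [Module k V']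
  {π : Representation k G V} {π' : Representation k G V'}

/-- **A `G`-map is an `H`-map of the restrictions** (`H ≤ G`): `f : π → π′` gives `f_H : π|_H → π′|_H` with the SAME underlying linear map
(★ `IntertwiningMap.restrictSubgroup` of `Automorphic/SmoothDualLevel` is this map as a definition; here its existence, import-light).
[cite: BernsteinZelevinsky1977, §1.8] [cite: BushnellHenniart2006, §2.4] -/
theorem exists_intertwiningMap_comp_subtype (H : Subgroup G) (f : π.IntertwiningMap π') :
    ∃ fH : IntertwiningMap (π.comp H.subtype) (π'.comp H.subtype), fH.toLinearMap = f.toLinearMap :=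
  ⟨f.toLinearMap.intertwiningMap_of_isIntertwiningMap _ _ fun h v => IntertwiningMap.isIntertwining _ _ f (h : G) v, rfl⟩

/-- More generally, **a `G`-map is an `H`-map of the pull-backs along any homomorphism `φ : H →* G`**. [cite: BernsteinZelevinsky1977, §1.8] -/
theorem exists_intertwiningMap_comp {H : Type*} [Group H] (φ : H →* G) (f : π.IntertwiningMap π') :
    ∃ fφ : IntertwiningMap (π.comp φ) (π'.comp φ), fφ.toLinearMap = f.toLinearMap :=
  ⟨f.toLinearMap.intertwiningMap_of_isIntertwiningMap _ _ fun h v => IntertwiningMap.isIntertwining _ _ f (φ h) v, rfl⟩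

/-- **A `G`-map intertwines the twists**: `f : π → π′` gives `π ⊗ χ → π′ ⊗ χ` with the SAME underlying linear map (`f (χ(g) • π(g) v) =
χ(g) • π′(g) (f v)`; ★ `IntertwiningMap.twist` of `Automorphic/SupercuspidalProjectiveGL` is this map as a definition).
[cite: BushnellHenniart2006, §9.5 (9.5.1) p. 65] [cite: BernsteinZelevinsky1977, §1.8] -/
theorem exists_intertwiningMap_twist (χ : G →* kˣ) (f : π.IntertwiningMap π') :
    ∃ fχ : IntertwiningMap (π.twist χ) (π'.twist χ), fχ.toLinearMap = f.toLinearMap :=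
  ⟨f.toLinearMap.intertwiningMap_of_isIntertwiningMap _ _ fun g v => by
    change f (((χ g : kˣ) : k) • π g v) = ((χ g : kˣ) : k) • π' g (f v)
    rw [map_smul, f.isIntertwining], rfl⟩

/-- Conversely **a map of twists intertwines the untwisted representations** (cancel the unit `χ(g)`; ★ `IntertwiningMap.ofTwist` as a
definition). [cite: BushnellHenniart2006, §9.5 (9.5.1) p. 65] -/
theorem exists_intertwiningMap_of_twist {k : Type*} [Field k] [Module k V] [Module k V'] {π : Representation k G V}
    {π' : Representation k G V'} (χ : G →* kˣ) (s : IntertwiningMap (π.twist χ) (π'.twist χ)) :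
    ∃ f : π.IntertwiningMap π', f.toLinearMap = s.toLinearMap :=
  ⟨s.toLinearMap.intertwiningMap_of_isIntertwiningMap _ _ fun g v => by
    have h : s (((χ g : kˣ) : k) • π g v) = ((χ g : kˣ) : k) • π' g (s v) := IntertwiningMap.isIntertwining _ _ s g v
    rw [map_smul] at h
    exact smul_right_injective V' (Units.ne_zero (χ g)) h, rfl⟩

/-- **Inflate-and-twist**: an `M`-map `u : σ → σ′` is a `P`-map `(σ ∘ φ) ⊗ χ → (σ′ ∘ φ) ⊗ χ` for every homomorphism `φ : P →* M` and character
`χ : P →* kˣ`, same underlying linear map — with `φ = proj_P`, `χ = δ_P^{1∕2}` this is the functoriality `i_P(u)` of NORMALISED induction on the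
inducing data (★ `IntertwiningMap.compTwist` of `Automorphic/ParabolicGLExactProofs` as a definition). [cite: BernsteinZelevinsky1977, §1.8, §2.3] -/
theorem exists_intertwiningMap_comp_twist {P M W W' : Type*} [Group P] [Group M] [AddCommGroup W] [Module k W] [AddCommGroup W'] [Module k W']
    {σ : Representation k M W} {σ' : Representation k M W'} (u : σ.IntertwiningMap σ') (φ : P →* M) (χ : P →* kˣ) :
    ∃ uP : IntertwiningMap (Representation.twist (σ.comp φ) χ) (Representation.twist (σ'.comp φ) χ), uP.toLinearMap = u.toLinearMap :=
  ⟨u.toLinearMap.intertwiningMap_of_isIntertwiningMap _ _ fun p w => by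
    change u (((χ p : kˣ) : k) • σ (φ p) w) = ((χ p : kˣ) : k) • σ' (φ p) (u w)
    rw [map_smul, u.isIntertwining], rfl⟩

end RestrictTwist

/-! ## §2 The normalised Jacquet map `r_P(f)` -/

section JacquetFunctor

variable {k G : Type*} [CommRing k] [Group G] (t : ParabolicTriple G)
  {V₁ V₂ V₃ : Type*} [AddCommGroup V₁] [Module k V₁] [AddCommGroup V₂] [Module k V₂] [AddCommGroup V₃] [Module k V₃]
  {ρ₁ : Representation k G V₁} {ρ₂ : Representation k G V₂} {ρ₃ : Representation k G V₃}

/-- **Functoriality of `jacquetMap`**: `r_P(g ∘ f) = r_P(g) ∘ r_P(f)`. [cite: BernsteinZelevinsky1977, §1.8] [cite: Casselman1995, §3.1] -/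
theorem jacquetMap_comp (f : ρ₁.IntertwiningMap ρ₂) (g : ρ₂.IntertwiningMap ρ₃) :
    jacquetMap t (g.comp f) = (jacquetMap t g).comp (jacquetMap t f) :=
  IntertwiningMap.ext (Coinvariants.hom_ext (LinearMap.ext fun _ => rfl))

/-- `r_P(id) = id` (on underlying linear maps). [cite: BernsteinZelevinsky1977, §1.8] -/
theorem jacquetMap_id_toLinearMap :
    (jacquetMap t (IntertwiningMap.id ρ₁)).toLinearMap = LinearMap.id :=
  Coinvariants.hom_ext (LinearMap.ext fun _ => rfl)

end JacquetFunctor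

section NormalizedJacquet

variable {G : Type*} [Group G] [TopologicalSpace G] [IsTopologicalGroup G]
  (t : ParabolicTriple G) [LocallyCompactSpace t.P]
  {V₁ V₂ V₃ : Type*} [AddCommGroup V₁] [Module ℂ V₁] [AddCommGroup V₂] [Module ℂ V₂] [AddCommGroup V₃] [Module ℂ V₃]
  {ρ₁ : Representation ℂ G V₁} {ρ₂ : Representation ℂ G V₂} {ρ₃ : Representation ℂ G V₃}

/-- **THE NORMALISED JACQUET MAP.**  For a `G`-map `f : π → π′`, the Jacquet map `jacquetMap t f : π_N → π′_N`, `[v] ↦ [f v]`, intertwines the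
NORMALISED actions `r_P π = π_N ⊗ δ_P^{−1∕2}` (★ `normalizedJacquet`): there is an `M`-map `g : r_P π → r_P π′` with the same underlying linear
map (so `g [v] = [f v]`).  The twist `δ_P^{−1∕2}(m)` is the same scalar on both sides. [cite: BernsteinZelevinsky1977, §1.8, §2.3] [cite: Casselman1995, §3.1] -/
theorem exists_normalizedJacquet_intertwiningMap (f : ρ₁.IntertwiningMap ρ₂) :
    ∃ g : (ρ₁.normalizedJacquet t).IntertwiningMap (ρ₂.normalizedJacquet t), g.toLinearMap = (jacquetMap t f).toLinearMap := by
  refine ⟨(jacquetMap t f).toLinearMap.intertwiningMap_of_isIntertwiningMap _ _ fun m x => ?_, rfl⟩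
  obtain ⟨v, rfl⟩ := Coinvariants.mk_surjective (t.restrict ρ₁) x
  change jacquetMap t f (ρ₁.normalizedJacquet t m (Coinvariants.mk (t.restrict ρ₁) v)) =
    ρ₂.normalizedJacquet t m (jacquetMap t f (Coinvariants.mk (t.restrict ρ₁) v))
  rw [normalizedJacquet_mk, map_smul, jacquetMap_mk, jacquetMap_mk, normalizedJacquet_mk, IntertwiningMap.isIntertwining]

/-- `mk`-form of the normalised Jacquet map: `∃ g : r_P π →_M r_P π′, g [v] = [f v]` for all `v`. [cite: BernsteinZelevinsky1977, §1.8, §2.3] -/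
theorem exists_normalizedJacquet_intertwiningMap_apply_mk (f : ρ₁.IntertwiningMap ρ₂) :
    ∃ g : (ρ₁.normalizedJacquet t).IntertwiningMap (ρ₂.normalizedJacquet t),
      ∀ v : V₁, g (Coinvariants.mk (t.restrict ρ₁) v) = Coinvariants.mk (t.restrict ρ₂) (f v) := by
  obtain ⟨g, hg⟩ := exists_normalizedJacquet_intertwiningMap t f
  refine ⟨g, fun v => ?_⟩
  rw [← IntertwiningMap.toLinearMap_apply, hg, IntertwiningMap.toLinearMap_apply, jacquetMap_mk]

/-- **THE NORMALISED JACQUET FUNCTOR IS EXACT** (transfer of ★ `jacquetMap_injective` ∕ `jacquetMap_exact` ∕ `jacquetMap_surjective`): along a short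
exact sequence `0 → π₁ →f π₂ →g π₃ → 0` of representations with `π₂` smooth, over a parabolic triple whose `N` is a union of compact open subgroups,
the normalised Jacquet maps `F = r_P(f)`, `G′ = r_P(g)` (same linear maps as the un-normalised ones) form a short exact sequence
`0 → r_P π₁ → r_P π₂ → r_P π₃ → 0` of `M`-representations. [cite: BernsteinZelevinsky1977, §1.9 Prop. 1.9 (a), §2.3] [cite: Casselman1995, §3.2 Thm. 3.2.3] -/
theorem exists_normalizedJacquet_shortExact (hN : IsLimitOfCompactOpen t.N) (h₂ : ρ₂.IsSmooth)
    (f : ρ₁.IntertwiningMap ρ₂) (g : ρ₂.IntertwiningMap ρ₃)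
    (hf : Function.Injective f) (hfg : Function.Exact f g) (hg : Function.Surjective g) :
    ∃ (F : (ρ₁.normalizedJacquet t).IntertwiningMap (ρ₂.normalizedJacquet t))
      (G' : (ρ₂.normalizedJacquet t).IntertwiningMap (ρ₃.normalizedJacquet t)),
      F.toLinearMap = (jacquetMap t f).toLinearMap ∧ G'.toLinearMap = (jacquetMap t g).toLinearMap ∧
        Function.Injective F ∧ Function.Exact F G' ∧ Function.Surjective G' := by
  obtain ⟨F, hF⟩ := exists_normalizedJacquet_intertwiningMap t f
  obtain ⟨G', hG'⟩ := exists_normalizedJacquet_intertwiningMap t g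
  have hFc : (F : (t.restrict ρ₁).Coinvariants → (t.restrict ρ₂).Coinvariants) = jacquetMap t f := by
    ext x; rw [← IntertwiningMap.toLinearMap_apply, hF, IntertwiningMap.toLinearMap_apply]
  have hGc : (G' : (t.restrict ρ₂).Coinvariants → (t.restrict ρ₃).Coinvariants) = jacquetMap t g := by
    ext x; rw [← IntertwiningMap.toLinearMap_apply, hG', IntertwiningMap.toLinearMap_apply]
  refine ⟨F, G', hF, hG', ?_, ?_, ?_⟩
  · rw [hFc]; exact jacquetMap_injective t hN h₂ f hf
  · rw [hFc, hGc]; exact jacquetMap_exact t f g hfg hg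
  · rw [hGc]; exact jacquetMap_surjective t g hg

end NormalizedJacquet

/-! ## §3 Frobenius naturality with the transport hypotheses discharged -/

section FrobeniusSmooth

variable {k G V V' W₁ : Type*} [CommRing k] [Group G] [TopologicalSpace G] [SeparatelyContinuousMul G]
  [AddCommGroup V] [Module k V] [AddCommGroup V'] [Module k V'] [AddCommGroup W₁] [Module k W₁]
  (H : Subgroup G) {σ : Representation k H W₁} {π : Representation k G V} {π' : Representation k G V'}

/-- **`e⁻¹(φ) ∘ f = e⁻¹(φ ∘ f|_H)`** — ★ FN `frobeniusInv_comp_eq` with its hypothesis `hφ` discharged by the restricted map of §1: for a `G`-map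
`f : π′ → π` and an `H`-map `φ : π|_H → σ` there IS `f_H : π′|_H → π|_H` over `f`, and `frobeniusInv (φ ∘ f_H) = frobeniusInv φ ∘ f`.
[cite: BernsteinZelevinsky1977, §1.8–§1.9] -/
theorem exists_frobeniusInv_comp (hπ : π.IsSmooth) (hπ' : π'.IsSmooth) (f : π'.IntertwiningMap π)
    (φ : IntertwiningMap (π.comp H.subtype) σ) :
    ∃ fH : IntertwiningMap (π'.comp H.subtype) (π.comp H.subtype), fH.toLinearMap = f.toLinearMap ∧
      frobeniusInv hπ' (φ.comp fH) = (frobeniusInv hπ φ).comp f := by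
  obtain ⟨fH, hfH⟩ := exists_intertwiningMap_comp_subtype H f
  exact ⟨fH, hfH, frobeniusInv_comp_eq H hπ hπ' f φ (φ.comp fH) (by rw [IntertwiningMap.comp_toLinearMap, hfH])⟩

end FrobeniusSmooth

section FrobeniusNormalized

variable {G : Type*} [Group G] [TopologicalSpace G] [IsTopologicalGroup G]
  (t : ParabolicTriple G) [LocallyCompactSpace t.P]
  {V V' W : Type*} [AddCommGroup V] [Module ℂ V] [AddCommGroup V'] [Module ℂ V'] [AddCommGroup W] [Module ℂ W]
  {π : Representation ℂ G V} {π' : Representation ℂ G V'} (σ : Representation ℂ t.M W)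

/-- **`E⁻¹(ψ) ∘ f = E′⁻¹(ψ ∘ r_P(f))`** — ★ FN `frobeniusNormalized_symm_comp` with its hypothesis `hψ` discharged by the normalised Jacquet map
of §2: for a `G`-map `f : π′ → π` and an `M`-map `ψ : r_P π → σ` there IS `g : r_P π′ → r_P π` over `jacquetMap t f`, and
`E′⁻¹(ψ ∘ g) = E⁻¹(ψ) ∘ f` (`E = (frobeniusEquiv hπ).trans (normalizedJacquetHomEquiv t π σ hδ)`; MEMO K4′ S7 «`adj(ψ) ∘ f = adj(ψ ∘ r(f))`»).
[cite: BernsteinZelevinsky1977, §1.9 Prop. 1.9 (b), §2.3] [cite: Casselman1995, §3.2 Thm. 3.2.4] -/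
theorem exists_frobeniusNormalized_symm_comp (hπ : π.IsSmooth) (hπ' : π'.IsSmooth)
    (hδ : ∀ (n : G) (hn : n ∈ t.N), deltaChar t.P ⟨n, t.N_le hn⟩ = 1)
    (f : π'.IntertwiningMap π) (ψ : (π.normalizedJacquet t).IntertwiningMap σ) :
    ∃ g : (π'.normalizedJacquet t).IntertwiningMap (π.normalizedJacquet t), g.toLinearMap = (jacquetMap t f).toLinearMap ∧
      ((frobeniusEquiv (H := t.P) (σ := Representation.twist (σ.comp t.proj) (rootDeltaChar t.P)) hπ').trans
          (normalizedJacquetHomEquiv t π' σ hδ)).symm (ψ.comp g) =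
        (((frobeniusEquiv (H := t.P) (σ := Representation.twist (σ.comp t.proj) (rootDeltaChar t.P)) hπ).trans
          (normalizedJacquetHomEquiv t π σ hδ)).symm ψ).comp f := by
  obtain ⟨g, hg⟩ := exists_normalizedJacquet_intertwiningMap t f
  exact ⟨g, hg, frobeniusNormalized_symm_comp t σ hπ hπ' hδ f ψ (ψ.comp g) (by rw [IntertwiningMap.comp_toLinearMap, hg])⟩

end FrobeniusNormalized

end Representation

end
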